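import Literature.AlgebraicGeometry.Motives.AbelianVarietyWeilPairingAnalytic
import Literature.AlgebraicGeometry.AbelianSchemes.AbelianSchemeSymplecticLevel
import HarnessLib

/-!
# The algebraic Weil pairing in lattice coordinates: Gram-matrix reading and the `δ`-normal form
# `ē_M^Θ(x̃/M, ỹ/M) = ζ_M ^ E_δ(x, y)`

Layer `Literature/AlgebraicGeometry/Motives`, namespace `Literature.AlgebraicGeometry.Motives.AbelianVariety`.  PROOF FILE
(theorems only; no definition, no named fact).  Sequel of the D5 head ★ `weilPairingLevel_eq_cexp`
(`ē_M^Θ(φ(π v), φ(π u)) = e(2πi M E(Φ v, Φ u))`, `E = c₁([𝒪(Θ)^an])`): for `M`-torsion points sitting at RATIONAL LATTICE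
COORDINATES `v = x̃/M`, `u = ỹ/M` (`x̃, ỹ ∈ ℤ^ι`) the exponent is the INTEGER Gram matrix of `E` on the lattice basis
(`intGram Φ E`, Lange §1.5.1):

  `ē_M^Θ(φ π(x̃/M), φ π(ỹ/M)) = e(2πi · ᵗx̃ G ỹ / M)`,   `G = intGram Φ E`      (`weilPairingLevel_eq_cexp_intGram`),

and when the lattice basis is SYMPLECTIC OF TYPE `δ` for `E` (`G = E_δ = (0 Δ; −Δ 0)`, the tree's `typeForm δ` — the Frobenius
/ Siegel normal form, Lange §3.1, Genestier–Ngô §1.2) this is the reading used by the level structures of the Siegel moduli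
problem:

  `ē_M^Θ(φ π(x̃/M), φ π(ỹ/M)) = ζ_M ^ E_δ(x, y)`,  `ζ_M = e(2πi/M)`, `E_δ(x, y) = typeFormMod δ M x y ∈ ℤ/M`
  (`weilPairingLevel_eq_exp_pow_typeFormMod`)

— verbatim the symplectic clause `hpair` of ★ `SiegelAdelicMarking.exists_symplecticLift_of_levelReading` (B4 (b),
`ModuliOfAbelianVarieties/SymplecticLiftOfMarking`) once the marking's torsion parametrisation is written in lattice coordinates.

## References
* [Lange2023AbelianVarietiesComplex] H. Lange, *Abelian Varieties over the Complex Numbers* (2023), §1.5.1 (Gram matrix on the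
  lattice), §3.1 (type of a polarisation, symplectic basis), §2.7.1 (2.13), §2.7.4 Exercise (3).
* [GenestierNgo2020] A. Genestier, B. C. Ngô, *Lectures on Shimura varieties*, §1.2–§1.3 ((1.3.1): the pairing `E_δ` on `L/ML`).
* [Lan2013PELCompactifications] K.-W. Lan, *Arithmetic compactifications of PEL-type Shimura varieties*, §1.3.6 Def. 1.3.6.1–1.3.6.2.
* [Milne1986AbelianVarieties] J. S. Milne, *Abelian varieties* (1986), §16 (the Riemann form of a polarisation as `e^λ`).
-/

noncomputable section

open CategoryTheory AlgebraicGeometry TopologicalSpace Set Function Filter Complex Matrix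
open scoped Manifold Topology Real
open Literature.Geometry.Kaehler Literature.Geometry.Kaehler.ComplexTorus
open Literature.NumberTheory.Transcendental Literature.AlgebraicGeometry.HodgeTheory
open Literature.AlgebraicGeometry.ModuliOfAbelianVarieties (typeForm)
open Literature.AlgebraicGeometry.AbelianSchemes (AbelianSchemeOver)

namespace Literature.AlgebraicGeometry.Motives.AbelianVariety

section NormalForm

variable {A : AbelianVariety ℂ} {ι : Type} [Fintype ι] [DecidableEq ι] {Φ : (ι → ℝ) ≃L[ℝ] (Fin A.dim → ℂ)}
  {φ : ComplexTorus Φ → ComplexPoints A.X} (hφ : IsAnalytification (Fin A.dim → ℂ) A.X A.dim φ)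
  (hadd : ∀ x y, φ (x + y) = φ x * φ y)

omit [DecidableEq ι] in
/-- `ᵗx̃ G_ℝ ỹ = ᵗx̃ G ỹ` for integer vectors: the real Gram matrix of `E ∈ NS(X)` IS the integer one (`map_intGram`).
[cite: Lange2023AbelianVarietiesComplex, §1.5.1] -/
theorem dotProduct_latticeGram_mulVec_intCast [DecidableEq ι] (p : AHData Φ) (x y : ι → ℤ) :
    (fun i ↦ (x i : ℝ)) ⬝ᵥ (latticeGram Φ p.form) *ᵥ (fun i ↦ (y i : ℝ)) =
      ((x ⬝ᵥ (intGram Φ p.form) *ᵥ y : ℤ) : ℝ) := by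
  rw [← map_intGram Φ p.isNSForm_form]
  simp only [dotProduct, Matrix.mulVec, Matrix.map_apply, Int.cast_sum, Int.cast_mul]

include hφ hadd in
/-- **Gram-matrix reading of the algebraic Weil pairing.**  For `M ≠ 0`, integer vectors `x̃, ỹ ∈ ℤ^ι` and the `M`-torsion
points `P = φ(π(x̃/M))`, `Q = φ(π(ỹ/M))`:  `ē_M^Θ(P, Q) = e(2πi · ᵗx̃ G ỹ / M)` with `G = intGram Φ E`, `E = c₁([𝒪(Θ)^an])`
(`p` any Appell–Humbert datum of `[𝒪(Θ)^an]`). [cite: Lange2023AbelianVarietiesComplex, §1.5.1 and §2.7.4 Exercise (3)]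
[cite: Milne1986AbelianVarieties, §16 (p. 132)] -/
theorem weilPairingLevel_eq_cexp_intGram {M : ℕ} [IsDominant (Hom.toSchemeHom ((M : ℤ) • 𝟙 A))] (hM : M ≠ 0)
    (Θ : CartierDivisor A.X.left) (p : AHData Φ) (hp : AHData.toPic p = picClass (cartierDivisorLineBundle hφ Θ))
    (x y : ι → ℤ) (P Q : A.torsionPoints ℂ M)
    (hP : (P : A.Points ℂ) = φ (proj Φ ((M : ℝ)⁻¹ • fun i ↦ (x i : ℝ))))
    (hQ : (Q : A.Points ℂ) = φ (proj Φ ((M : ℝ)⁻¹ • fun i ↦ (y i : ℝ)))) :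
    (A.weilPairingLevel Θ P Q : ℂ) =
      cexp (2 * π * I * ((((x ⬝ᵥ (intGram Φ p.form) *ᵥ y : ℤ) : ℝ) / M : ℝ) : ℂ)) := by
  rw [weilPairingLevel_eq_cexp hφ hadd Θ p hp _ _ P Q hP hQ]
  congr 3
  have hMr : (M : ℝ) ≠ 0 := Nat.cast_ne_zero.2 hM
  rw [← dotProduct_latticeGram_mulVec Φ p.form, Matrix.mulVec_smul, dotProduct_smul, smul_dotProduct,
    dotProduct_latticeGram_mulVec_intCast p x y, smul_eq_mul, smul_eq_mul]
  field_simp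

/-- The integer `ᵗx̃ E_δ ỹ` reduces mod `M` to `E_δ(x, y) = typeFormMod δ M x y` for `x = x̃ mod M`, `y = ỹ mod M`.
[cite: GenestierNgo2020, §1.3 (1.3.1)] -/
theorem intCast_dotProduct_typeForm_mulVec {g : ℕ} (δ : Fin g → ℕ) (M : ℕ) (x y : Fin g ⊕ Fin g → ℤ) :
    (((x ⬝ᵥ (typeForm δ) *ᵥ y : ℤ)) : ZMod M) =
      AbelianSchemeOver.typeFormMod δ M (fun i ↦ (x i : ZMod M)) (fun i ↦ (y i : ZMod M)) := by
  rw [AbelianSchemeOver.typeFormMod_apply, dotProduct]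
  push_cast
  refine Finset.sum_congr rfl fun i _ ↦ ?_
  rw [Matrix.mulVec, dotProduct]
  push_cast
  rw [Finset.mul_sum]
  refine Finset.sum_congr rfl fun j _ ↦ ?_
  ring

/-- `e(2πi k / M) = e(2πi / M) ^ (k mod M)` for an integer `k` (`M ≠ 0`). [folklore] -/
private theorem cexp_intCast_div_eq_pow {M : ℕ} (hM : M ≠ 0) (k : ℤ) :
    cexp (2 * π * I * (((k : ℝ) / M : ℝ) : ℂ)) = cexp (2 * π * I / M) ^ ((k : ZMod M).val) := by
  haveI : NeZero M := ⟨hM⟩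
  have hMc : (M : ℂ) ≠ 0 := Nat.cast_ne_zero.2 hM
  set ζ := cexp (2 * π * I / M) with hζ
  have hζM : ζ ^ M = 1 := by
    rw [hζ, ← Complex.exp_nat_mul, mul_div_cancel₀ _ hMc, Complex.exp_two_pi_mul_I]
  have h1 : cexp (2 * π * I * (((k : ℝ) / M : ℝ) : ℂ)) = ζ ^ k := by
    rw [hζ, ← Complex.exp_int_mul]
    congr 1
    push_cast
    ring
  have hr : ((k : ZMod M).val : ℤ) = k % M := ZMod.val_intCast k
  have hk : k = M * (k / M) + ((k : ZMod M).val : ℤ) := by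
    rw [hr]
    have := Int.emod_add_mul_ediv k (M : ℤ)
    linarith
  rw [h1]
  conv_lhs => rw [hk]
  rw [zpow_add₀ (Complex.exp_ne_zero _), ← hζ, _root_.zpow_mul, zpow_natCast, hζM, _root_.one_zpow, one_mul,
    zpow_natCast]

end NormalForm

section TypeDelta

variable {A : AbelianVariety ℂ} {g : ℕ} {δ : Fin g → ℕ} {Φ : (Fin g ⊕ Fin g → ℝ) ≃L[ℝ] (Fin A.dim → ℂ)}
  {φ : ComplexTorus Φ → ComplexPoints A.X} (hφ : IsAnalytification (Fin A.dim → ℂ) A.X A.dim φ)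
  (hadd : ∀ x y, φ (x + y) = φ x * φ y)

include hφ hadd in
/-- **The `δ`-normal form: `ē_M^Θ(φ π(x̃/M), φ π(ỹ/M)) = ζ_M ^ E_δ(x, y)`, `ζ_M = e(2πi/M)`.**  If the lattice basis is
symplectic of type `δ` for `E = c₁([𝒪(Θ)^an])` (`intGram Φ E = typeForm δ`, index `ι = Fin g ⊕ Fin g`), then for
`x, y ∈ (ℤ/M)^{2g}` and the `M`-torsion points at the lattice coordinates `x̃/M`, `ỹ/M` of their standard lifts, the algebraic
Weil pairing of `Θ` is `ζ_M ^ (typeFormMod δ M x y).val` — the symplectic clause `hpair` of the B4 (b) symplectic-lift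
construction. [cite: GenestierNgo2020, §1.2 and §1.3 (1.3.1)] [cite: Lan2013PELCompactifications, §1.3.6 Def. 1.3.6.2]
[cite: Lange2023AbelianVarietiesComplex, §3.1 and §2.7.4 Exercise (3)] -/
theorem weilPairingLevel_eq_exp_pow_typeFormMod {M : ℕ} [IsDominant (Hom.toSchemeHom ((M : ℤ) • 𝟙 A))] (hM : M ≠ 0)
    (Θ : CartierDivisor A.X.left) (p : AHData Φ) (hp : AHData.toPic p = picClass (cartierDivisorLineBundle hφ Θ))
    (hT : intGram Φ p.form = typeForm δ) (x y : Fin g ⊕ Fin g → ZMod M) (P Q : A.torsionPoints ℂ M)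
    (hP : (P : A.Points ℂ) = φ (proj Φ ((M : ℝ)⁻¹ • fun i ↦ ((x i).val : ℝ))))
    (hQ : (Q : A.Points ℂ) = φ (proj Φ ((M : ℝ)⁻¹ • fun i ↦ ((y i).val : ℝ)))) :
    (A.weilPairingLevel Θ P Q : ℂ) = cexp (2 * π * I / M) ^ (AbelianSchemeOver.typeFormMod δ M x y).val := by
  haveI : NeZero M := ⟨hM⟩
  have hP' : (P : A.Points ℂ) = φ (proj Φ ((M : ℝ)⁻¹ • fun i ↦ ((((x i).val : ℕ) : ℤ) : ℝ))) := by
    rw [hP]; rfl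
  have hQ' : (Q : A.Points ℂ) = φ (proj Φ ((M : ℝ)⁻¹ • fun i ↦ ((((y i).val : ℕ) : ℤ) : ℝ))) := by
    rw [hQ]; rfl
  rw [weilPairingLevel_eq_cexp_intGram hφ hadd hM Θ p hp _ _ P Q hP' hQ', cexp_intCast_div_eq_pow hM, hT,
    intCast_dotProduct_typeForm_mulVec]
  congr 3 <;> funext i <;> simp

end TypeDelta


end Literature.AlgebraicGeometry.Motives.AbelianVariety

end
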